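import Summits.QuantumFields.YangMills.Theorems.BalabanUVNodesN18KernelLettersSuperposition
import Summits.QuantumFields.YangMills.Theorems.BalabanUVNodesN18RunningBetaLettersModelNodes
import Summits.QuantumFields.BalabanUV.Beta.B12AsPrintedRowD4Junction

/-!
# BalabanUVNodes ∕ N18 — SUPERPOSITION, PART 2 (β SIDE): def-B's (1.22) β-map under sums of term families; DESIGN (β) = DESIGN (α) under a
# coupling-free ∕ remainder decomposition of the merged term — the (2.12) clause `Beta0LimitExists` with a HISTORY-FREE one-loop number and the corner anchor from
# the decomposition; the model inhabitant (A6) for both parts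
# (Track A, DAG node N18 = NE5; key K3⁷ `SpineGivenEndpointR13SepCoPH` = stmt-QuantumFields-20544, skeleton v5 941dddb108cbaacf; cell `pub-ymgap`, WIDTH SEAT
# `pub-ymgap-dag-n18-w2` g8, FILE 2; `--kind proof --supports stmt-QuantumFields-20544 --as helper`, COUNT-NEUTRAL; THEOREMS ONLY, 0 `def`, 0 `sorry`)

WHY.  def-B (`Node00/BetaOfRecord`) types the β-functions twice: DESIGN (α) from TWO term families — the coupling-free `ℰ⁰ : TermFamily0` (print's `log Z^{(k)}`,
[I] (1.3)–(1.4) p. 260, (2.12) p. 268) and the remainder `ℰ¹ : TermFamily1` ((2.13) p. 268) — as `betaOfTerms ℰ⁰ ℰ¹ γ = β⁰ + 𝟙_box·β¹` with the one-loop split BY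
CONSTRUCTION; and DESIGN (β) from ONE merged family `ℰ` ((1.6)) as `betaMerged F ℰ`, with the one-loop number the `g_k → 0⁺` `limUnder` OBJECT `beta0OfMerged` and the
(2.12) clause `Beta0LimitExists` a displayed hypothesis of 30+ consumers (the record is built on design (β)).  def-B's docstring of `betaOfTerms` carries the junction as a
parenthetical — «ON the box this is the printed β of the merged term (1.6) ((1.22) is additive in the kernel)» — proved nowhere.  PART 1 made (1.20)–(1.21) additive;
THIS FILE adds (1.22) (a `tsum`: additive under SUMMABILITY, which the (5.10) class supplies) and draws the consequences: the merged β of `ℰ⁰ + ℰ¹` IS design (α)'s β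
on the box; if the remainder's β¹ → 0 at the face `g_k → 0⁺` (print p. 268 «vanishes at g_k = 0», read as a one-sided limit since the box is open) then `Beta0LimitExists`
HOLDS with the HISTORY-FREE one-loop number `beta0OfTerms ℰ⁰`, whatever the reference history `v₀`; if β¹ → 0 at the CORNER, the merged β carries the per-scale anchor
(K2 ∕ U3's corner letter `ScaleAnchor`, stated by its body) at the same history-free numbers.

WHAT.  §1 (1.22) UNDER SUMS ((1.22) additive in the kernel under summability = the β sub-cell's `B12AsPrintedRowD4Junction.secondMoment_add`, CITED): `summable_moment_of_decay510` · ★ `betaMerged_add` (both (1.21) limits exist, both limiting kernels in the (5.10)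
class at a rate `δ > 0`) · `betaMerged_add_of_letters` (on the boxes of `]0, γ]` from W1-19b's `PolLimitsExist` + W1-19's `KernelDecay … 0 1 κ`) · `betaOfMerged_add` ·
`tendsto_face_add` ∕ ★ `beta0LimitExists_add`.  §2 DESIGN (β) = DESIGN (α): ★★ `betaMerged_eq_beta0OfTerms_add_beta1OfTerms` (an EVENTUAL-in-`K`
decomposition `ℰ k v K = ℰ⁰ k K + ℰ¹ k v K`, `C²` charts, (1.21) existence and (5.10) class for the two pieces ⟹ `betaMerged F ℰ k v = beta0OfTerms F ℰ⁰ k +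
beta1OfTerms F ℰ¹ k v`) · ★ `betaMerged_eq_betaOfTerms_of_mem_box` · ★★ `beta0LimitExists_of_decomposition` + `beta0OfMerged_eq_beta0OfTerms` (the (2.12) clause FROM the
decomposition + face-continuity of β¹, value HISTORY-FREE) · ★ `betaOfMerged_betaMerged_eq_betaOfTerms` · ★ `cornerAnchor_of_decomposition` (the body of K2's
`ScaleAnchor (betaMerged F ℰ) (beta0OfTerms F ℰ⁰)`).  §3 MODEL INHABITANT (A6, for PART 1 and §1–§2): sums of dag-n18-w2 g7's two-bond families —
`contDiffAt_expChart_crossTermFamily` (charts `C^∞`), ★ `kernelA_cross_add`, `kernelStepRate_cross_add`, `betaMerged_cross_add`; THE DECOMPOSITION INSTANCE with law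
`b₀ k + v_k` (coupling-free numbers PLUS the last coupling): `cross_decomposition`, `betaMerged_crossRunning_split`, ★ `beta0LimitExists_crossRunning` (a RUNNING β with the
(2.12) clause and history-free one-loop number `b₀ k·e₀e₁` at EVERY reference history — §2 applied NON-VACUOUSLY), `cornerAnchor_crossRunning`.

HONEST FRAMING — what this is NOT.  Count-neutral `tsum` ∕ filter ∕ indicator bookkeeping over def-B's definitions; NO estimate of Bałaban's is proved or asserted;
the decomposition `ℰ = ℰ⁰ + ℰ¹` of the merged term OF RECORD (that (1.6) is `log Z^{(k)}` + (2.13) up to terms with vanishing polarization), the (1.21) existence,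
the (5.10) class and the face-continuity of β¹ are DISPLAYED hypotheses — print's content ([I] §1–§2, §5), NODE O's ∕ N10's ∕ def-W1's, inhabited here at MODEL
level only; `Beta0LimitExists` OF RECORD is NOT discharged; nothing of Bałaban's constructed; N18 ∕ N22 ∕ (D4) NOT discharged; K3⁷ OPEN, not claimed; counts UNMOVED
(typed 28∕28 · discharged 5∕27 (A 5∕28)); one finite four-torus programme at fixed ε, Bałaban AS PRINTED; R4 closes the conditional finite-𝕋⁴ rung `BalabanLadder.UV`
only — NOT ℝ⁴, NOT infinite volume, NOT OS, NOT a mass gap; the Clay problem is NOT proved by any of this.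

References (TYPES only): [I] = [Balaban1987RG1] (1.3)–(1.4) p. 260, (1.6) p. 261, (1.20)–(1.22) p. 264, (2.12)–(2.14) p. 268, (5.10) p. 293, (5.42) p. 297.  Imports PART 1,
dag-n18-w2 g7's `…N18RunningBetaLettersModelNodes` (p613743) and an4's `Summits/QuantumFields/BalabanUV/Beta/B12AsPrintedRowD4Junction` (`secondMoment_add`) BY NAME; K2's `ScaleAnchor` (`Thm/BalabanUVNodesK2NamedJetsRemAt`, a module importing the route
file) enters by its BODY, definitionally; nothing re-declared.
-/

noncomputable section

namespace YMDAG.N18.BetaSuperposition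

open Filter
open scoped BigOperators Topology
open Literature.MathematicalPhysics.QuantumFieldTheory.Balaban1983to89
open Literature.MathematicalPhysics.QuantumFieldTheory.Balaban1983to89.T4Continuum (T4Family)
open Literature.MathematicalPhysics.QuantumFieldTheory.Balaban1983to89.T4OutputRate (Window)
open Literature.MathematicalPhysics.QuantumFieldTheory.Balaban1983to89.B12Sec2to5 (l1 Decay510 secondMoment_abs_le_of_decay510)
open Literature.MathematicalPhysics.QuantumFieldTheory.Balaban1983to89.B12Beta (secondMoment HistBox)
open Literature.MathematicalPhysics.QuantumFieldTheory.Balaban1983to89.FlowStep (Box HBeta)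
open Literature.MathematicalPhysics.QuantumFieldTheory.Balaban1983to89.T4FlagMemory (extd)
open Literature.MathematicalPhysics.QuantumFieldTheory.Balaban1983to89.B12PolarizationTensor120 (expChart)
open Literature.MathematicalPhysics.QuantumFieldTheory.Balaban1983to89.Node00 (TermFamily0 TermFamily1 siteOfInt polWindow polLimit PolLimitExists betaMerged
  beta0OfTerms beta1OfTerms betaOfTerms betaOfTerms_of_mem betaOfMerged betaOfMerged_of_mem betaOfMerged_of_notMem beta0OfMerged Beta0LimitExists)
open Literature.MathematicalPhysics.QuantumFieldTheory.Balaban1983to89.Node00.U3OfKernels (histPrefix kernelA KernelDecay kernelA_extd)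
open Literature.MathematicalPhysics.QuantumFieldTheory.Balaban1983to89.Node00.U3KernelLetters (PolLimitsExist KernelStepRate)
open YMDAG.N18.KernelLettersSuperposition (polLimit_add polLimitExists_add kernelA_add kernelStepRate_add polLimitsExist_add)
open Summit.QuantumFields.BalabanUV.Beta.B12AsPrintedRowD4Junction (secondMoment_add)
open YMDAG.N18.FiniteVolumeLettersModel (bondEval)
open YMDAG.N18.RunningBetaLettersModel (crossTermFamily crossKernel crossKernel_zero_one expChart_crossMul polLimit_crossTermFamily polLimitExists_crossTermFamily
  kernelA_crossTermFamily betaMerged_crossTermFamily polLimitsExist_cross kernelStepRate_cross wt)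

/-! ## §1 (1.22) under sums: the second moment, the merged β, def-B's box convention and the (2.12) clause -/

section SecondMoment

/-- The (5.10) class at a positive rate makes the moment summand summable (pv10 ∕ t4 `secondMoment_abs_le_of_decay510`, dominated summation).
[cite: Balaban1987RG1, (5.10) p.293 and (5.42) p.297] -/
theorem summable_moment_of_decay510 {P : B12Beta.Kernel 4} {μ ν : Fin 4} {C δ : ℝ} (hδ : 0 < δ) (h : Decay510 (P μ ν) C δ) :
    Summable fun x : Fin 4 → ℤ => P μ ν x * (x μ : ℝ) * (x ν : ℝ) :=
  (secondMoment_abs_le_of_decay510 (P := P) hδ h).1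

end SecondMoment

section Merged

variable {𝔄 : Type*} [NormedRing 𝔄] [NormedAlgebra ℝ 𝔄] {V : Type*} [NormedAddCommGroup V] [NormedSpace ℝ V] {ι : Type*} [Fintype ι]
variable (F : T4Family) (ℰ₁ ℰ₂ : TermFamily1 F 𝔄) (ρ : V →L[ℝ] 𝔄) (bV : Module.Basis ι ℝ V)

/-- ★ **def-B's MERGED β IS ADDITIVE IN THE TERM FAMILY** at every level `k` and history `v` where both (1.21) limits exist and both limiting kernels are in the (5.10) class
at a rate `δ > 0` (charts `C²` at `0`): `β_m[ℰ₁ + ℰ₂](v) = β_m[ℰ₁](v) + β_m[ℰ₂](v)`. [cite: Balaban1987RG1, (1.20)–(1.22) p.264 and (5.10) p.293] -/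
theorem betaMerged_add (hC₁ : ∀ k hist K, ContDiffAt ℝ 2 (expChart (ℰ₁ k hist K) ρ) 0) (hC₂ : ∀ k hist K, ContDiffAt ℝ 2 (expChart (ℰ₂ k hist K) ρ) 0)
    {k : ℕ} {v : Fin (k + 1) → ℝ} (h₁ : PolLimitExists F (k + 1) (fun K => ℰ₁ k v K) ρ bV) (h₂ : PolLimitExists F (k + 1) (fun K => ℰ₂ k v K) ρ bV)
    {δ C₁ C₂ : ℝ} (hδ : 0 < δ) (hD₁ : Decay510 (polLimit F (k + 1) (fun K => ℰ₁ k v K) ρ bV 0 1) C₁ δ)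
    (hD₂ : Decay510 (polLimit F (k + 1) (fun K => ℰ₂ k v K) ρ bV 0 1) C₂ δ) :
    betaMerged F (ℰ₁ + ℰ₂) ρ bV k v = betaMerged F ℰ₁ ρ bV k v + betaMerged F ℰ₂ ρ bV k v := by
  unfold betaMerged
  have h := polLimit_add F (k + 1) (fun K => ℰ₁ k v K) (fun K => ℰ₂ k v K) ρ bV (fun K => hC₁ k v K) (fun K => hC₂ k v K) h₁ h₂
  rw [show (fun K => (ℰ₁ + ℰ₂) k v K) = fun K U => ℰ₁ k v K U + ℰ₂ k v K U from rfl, h]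
  exact secondMoment_add _ _ 0 1 (summable_moment_of_decay510 hδ hD₁) (summable_moment_of_decay510 hδ hD₂)

/-- **ON EVERY BOX OF `]0, γ]`, FROM THE LETTERS**: W1-19b's `PolLimitsExist` and W1-19's `KernelDecay … 0 1 κ` (`κ > 0`) on the window `]0, γ]^ℕ` for both summands make the merged
β additive at every box history (the box history is read along its padded sequence `extd v ∈ Window γ`, `kernelA_extd`). [cite: Balaban1987RG1, (1.21)–(1.22) p.264 and (5.10) p.293] -/
theorem betaMerged_add_of_letters (hC₁ : ∀ k hist K, ContDiffAt ℝ 2 (expChart (ℰ₁ k hist K) ρ) 0) (hC₂ : ∀ k hist K, ContDiffAt ℝ 2 (expChart (ℰ₂ k hist K) ρ) 0)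
    {γ κ : ℝ} (hκ : 0 < κ) (hP₁ : PolLimitsExist F ℰ₁ ρ bV (Window γ)) (hP₂ : PolLimitsExist F ℰ₂ ρ bV (Window γ))
    (hD₁ : KernelDecay F ℰ₁ ρ bV (Window γ) 0 1 κ) (hD₂ : KernelDecay F ℰ₂ ρ bV (Window γ) 0 1 κ) {k : ℕ} {v : Fin (k + 1) → ℝ} (hv : v ∈ Box γ k) :
    betaMerged F (ℰ₁ + ℰ₂) ρ bV k v = betaMerged F ℰ₁ ρ bV k v + betaMerged F ℰ₂ ρ bV k v := by
  have hw : extd v ∈ Window γ := T4BetaReadOut.extd_mem_window hv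
  obtain ⟨D₁, hK₁⟩ := hD₁ (extd v) hw
  obtain ⟨D₂, hK₂⟩ := hD₂ (extd v) hw
  have e₁ := kernelA_extd F ℰ₁ ρ bV v
  have e₂ := kernelA_extd F ℰ₂ ρ bV v
  have p₁ := hP₁ (extd v) hw k
  have p₂ := hP₂ (extd v) hw k
  rw [Node00.U3OfKernels.histPrefix_extd] at p₁ p₂
  refine betaMerged_add F ℰ₁ ℰ₂ ρ bV hC₁ hC₂ p₁ p₂ hκ (C₁ := D₁) (C₂ := D₂) ?_ ?_
  · rw [← e₁]; exact hK₁ k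
  · rw [← e₂]; exact hK₂ k

end Merged

section BoxConvention

/-- **def-B's BOX CONVENTION IS ADDITIVE** in the pair (merged β, one-loop number): `betaOfMerged (β₁ + β₂) (b₁ + b₂) γ = betaOfMerged β₁ b₁ γ + betaOfMerged β₂ b₂ γ`
(on the box both sides read the merged β's, off it the numbers). [cite: Balaban1987RG1, (1.22) p.264 and (2.12)–(2.14) p.268] -/
theorem betaOfMerged_add (β₁ β₂ : HBeta) (b₁ b₂ : ℕ → ℝ) (γ : ℝ) :
    betaOfMerged (β₁ + β₂) (b₁ + b₂) γ = betaOfMerged β₁ b₁ γ + betaOfMerged β₂ b₂ γ := by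
  funext k v
  by_cases hv : v ∈ Box γ k
  · simp only [Pi.add_apply, betaOfMerged_of_mem _ _ _ hv]
  · simp only [Pi.add_apply, betaOfMerged_of_notMem _ _ _ hv]

/-- If along the face `g_k → 0⁺` at the reference history a β-function EVENTUALLY splits as `β₁ + β₂` and both pieces have one-sided limits `c₁`, `c₂`, the β-function tends to
`c₁ + c₂` there. [cite: Balaban1987RG1, (2.12)–(2.14) p.268] -/
theorem tendsto_face_add {β β₁ β₂ : HBeta} {v₀ : (k : ℕ) → (Fin (k + 1) → ℝ)} {k : ℕ} {c₁ c₂ : ℝ}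
    (hdec : ∀ᶠ g in 𝓝[>] (0 : ℝ), β k (Function.update (v₀ k) (Fin.last k) g) =
      β₁ k (Function.update (v₀ k) (Fin.last k) g) + β₂ k (Function.update (v₀ k) (Fin.last k) g))
    (h₁ : Tendsto (fun g : ℝ => β₁ k (Function.update (v₀ k) (Fin.last k) g)) (𝓝[>] 0) (𝓝 c₁))
    (h₂ : Tendsto (fun g : ℝ => β₂ k (Function.update (v₀ k) (Fin.last k) g)) (𝓝[>] 0) (𝓝 c₂)) :
    Tendsto (fun g : ℝ => β k (Function.update (v₀ k) (Fin.last k) g)) (𝓝[>] 0) (𝓝 (c₁ + c₂)) :=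
  (h₁.add h₂).congr' (hdec.mono fun _ hg => hg.symm)

/-- ★ **THE (2.12) CLAUSE IS ADDITIVE**: an eventual split along every face with `Beta0LimitExists` for both pieces gives `Beta0LimitExists` for the sum (and the one-loop numbers add,
`limUnder` of the summed limit). [cite: Balaban1987RG1, (2.12)–(2.14) p.268] -/
theorem beta0LimitExists_add {β β₁ β₂ : HBeta} {v₀ : (k : ℕ) → (Fin (k + 1) → ℝ)}
    (hdec : ∀ k, ∀ᶠ g in 𝓝[>] (0 : ℝ), β k (Function.update (v₀ k) (Fin.last k) g) =
      β₁ k (Function.update (v₀ k) (Fin.last k) g) + β₂ k (Function.update (v₀ k) (Fin.last k) g))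
    (h₁ : Beta0LimitExists β₁ v₀) (h₂ : Beta0LimitExists β₂ v₀) : Beta0LimitExists β v₀ := fun k =>
  ⟨_, tendsto_face_add (hdec k) (Node00.tendsto_beta0OfMerged β₁ v₀ h₁ k) (Node00.tendsto_beta0OfMerged β₂ v₀ h₂ k)⟩

end BoxConvention

/-! ## §2 DESIGN (β) = DESIGN (α): the merged β of a coupling-free ∕ remainder decomposition, the (2.12) clause with a history-free one-loop number, the corner anchor -/

section Designs

variable {𝔄 : Type*} [NormedRing 𝔄] [NormedAlgebra ℝ 𝔄] {V : Type*} [NormedAddCommGroup V] [NormedSpace ℝ V] {ι : Type*} [Fintype ι]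
variable (F : T4Family) (ℰ : TermFamily1 F 𝔄) (ℰ0 : TermFamily0 F 𝔄) (ℰ1 : TermFamily1 F 𝔄) (ρ : V →L[ℝ] 𝔄) (bV : Module.Basis ι ℝ V)

/-- ★★ **«(1.22) IS ADDITIVE IN THE KERNEL» — THE JUNCTION OF def-B's TWO DESIGNS**: if at level `k` and history `v` the merged family is, EVENTUALLY IN THE VOLUME, the sum of a
coupling-free piece `ℰ⁰ k` and a remainder `ℰ¹ k v` whose charts are `C²` at `0`, whose (1.21) limits exist and whose limiting kernels' `(0,1)` entries are in the (5.10) class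
at a rate `δ > 0`, then design (β)'s merged β IS design (α)'s split value: `betaMerged F ℰ k v = beta0OfTerms F ℰ⁰ k + beta1OfTerms F ℰ¹ k v` (the merged family's own limit need
not be displayed: a `limUnder` of eventually equal sequences is the same, `LocalizedSum17.polLimit_congr_of_eventually`). [cite: Balaban1987RG1, (1.22) p.264 and (2.12)–(2.14) p.268] -/
theorem betaMerged_eq_beta0OfTerms_add_beta1OfTerms {k : ℕ} {v : Fin (k + 1) → ℝ}
    (hdec : ∀ᶠ K in atTop, ℰ k v K = fun W => ℰ0 k K W + ℰ1 k v K W)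
    (hC0 : ∀ K, ContDiffAt ℝ 2 (expChart (ℰ0 k K) ρ) 0) (hC1 : ∀ K, ContDiffAt ℝ 2 (expChart (ℰ1 k v K) ρ) 0)
    (hP0 : PolLimitExists F (k + 1) (fun K => ℰ0 k K) ρ bV) (hP1 : PolLimitExists F (k + 1) (fun K => ℰ1 k v K) ρ bV) {δ C0 C1 : ℝ} (hδ : 0 < δ)
    (hD0 : Decay510 (polLimit F (k + 1) (fun K => ℰ0 k K) ρ bV 0 1) C0 δ) (hD1 : Decay510 (polLimit F (k + 1) (fun K => ℰ1 k v K) ρ bV 0 1) C1 δ) :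
    betaMerged F ℰ ρ bV k v = beta0OfTerms F ℰ0 ρ bV k + beta1OfTerms F ℰ1 ρ bV k v := by
  obtain ⟨K₀, hK₀⟩ := eventually_atTop.1 hdec
  have hlim : polLimit F (k + 1) (fun K => ℰ k v K) ρ bV = polLimit F (k + 1) (fun K U => ℰ0 k K U + ℰ1 k v K U) ρ bV :=
    Node00.LocalizedSum17.polLimit_congr_of_eventually F ρ bV (k + 1) _ _ ⟨K₀, fun K hK => hK₀ K hK⟩
  unfold betaMerged beta0OfTerms beta1OfTerms
  rw [hlim, polLimit_add F (k + 1) (fun K => ℰ0 k K) (fun K => ℰ1 k v K) ρ bV hC0 hC1 hP0 hP1]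
  exact secondMoment_add _ _ 0 1 (summable_moment_of_decay510 hδ hD0) (summable_moment_of_decay510 hδ hD1)

/-- ★ **ON THE BOX, design (β)'s merged β IS design (α)'s β-function `betaOfTerms`** (def-B's «ON the box this is the printed β of the merged term (1.6)»).
[cite: Balaban1987RG1, (1.22) p.264 and (2.12)–(2.14) p.268] -/
theorem betaMerged_eq_betaOfTerms_of_mem_box {γ : ℝ} {k : ℕ} {v : Fin (k + 1) → ℝ} (hv : v ∈ Box γ k)
    (hdec : ∀ᶠ K in atTop, ℰ k v K = fun W => ℰ0 k K W + ℰ1 k v K W)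
    (hC0 : ∀ K, ContDiffAt ℝ 2 (expChart (ℰ0 k K) ρ) 0) (hC1 : ∀ K, ContDiffAt ℝ 2 (expChart (ℰ1 k v K) ρ) 0)
    (hP0 : PolLimitExists F (k + 1) (fun K => ℰ0 k K) ρ bV) (hP1 : PolLimitExists F (k + 1) (fun K => ℰ1 k v K) ρ bV) {δ C0 C1 : ℝ} (hδ : 0 < δ)
    (hD0 : Decay510 (polLimit F (k + 1) (fun K => ℰ0 k K) ρ bV 0 1) C0 δ) (hD1 : Decay510 (polLimit F (k + 1) (fun K => ℰ1 k v K) ρ bV 0 1) C1 δ) :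
    betaMerged F ℰ ρ bV k v = betaOfTerms F ℰ0 ℰ1 ρ bV γ k v := by
  rw [betaOfTerms_of_mem F ℰ0 ℰ1 ρ bV γ hv]
  exact betaMerged_eq_beta0OfTerms_add_beta1OfTerms F ℰ ℰ0 ℰ1 ρ bV hdec hC0 hC1 hP0 hP1 hδ hD0 hD1

/-- ★★ **THE (2.12) CLAUSE DISCHARGED FROM THE DECOMPOSITION, WITH A HISTORY-FREE ONE-LOOP NUMBER.**  At a reference history `v₀`, if for every step `k` the junction
`β_m(·) = β⁰_k + β¹_k(·)` holds EVENTUALLY along the face `g_k → 0⁺` (e.g. by `betaMerged_eq_beta0OfTerms_add_beta1OfTerms` at the histories `update (v₀ k) last g`, `g` small)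
and the remainder's β¹ tends to `0` there (print p. 268 «vanishes at g_k = 0», as a one-sided limit), then `Beta0LimitExists (betaMerged F ℰ) v₀` HOLDS and the one-loop number
is `beta0OfTerms F ℰ⁰ k` — independent of `v₀`. [cite: Balaban1987RG1, (2.12)–(2.14) p.268 and (1.22) p.264] -/
theorem beta0LimitExists_of_decomposition {v₀ : (k : ℕ) → (Fin (k + 1) → ℝ)}
    (hsplit : ∀ k, ∀ᶠ g in 𝓝[>] (0 : ℝ), betaMerged F ℰ ρ bV k (Function.update (v₀ k) (Fin.last k) g) =
      beta0OfTerms F ℰ0 ρ bV k + beta1OfTerms F ℰ1 ρ bV k (Function.update (v₀ k) (Fin.last k) g))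
    (hvan : ∀ k, Tendsto (fun g : ℝ => beta1OfTerms F ℰ1 ρ bV k (Function.update (v₀ k) (Fin.last k) g)) (𝓝[>] 0) (𝓝 0)) :
    Beta0LimitExists (betaMerged F ℰ ρ bV) v₀ ∧ ∀ k, beta0OfMerged (betaMerged F ℰ ρ bV) v₀ k = beta0OfTerms F ℰ0 ρ bV k := by
  have ht : ∀ k, Tendsto (fun g : ℝ => betaMerged F ℰ ρ bV k (Function.update (v₀ k) (Fin.last k) g)) (𝓝[>] 0) (𝓝 (beta0OfTerms F ℰ0 ρ bV k)) := by
    intro k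
    have h := (tendsto_const_nhds (x := beta0OfTerms F ℰ0 ρ bV k) (f := (𝓝[>] (0 : ℝ)))).add (hvan k)
    rw [add_zero] at h
    exact h.congr' ((hsplit k).mono fun g hg => hg.symm)
  exact ⟨fun k => ⟨_, ht k⟩, fun k => (ht k).limUnder_eq⟩

/-- The value statement alone. [cite: Balaban1987RG1, (2.12)–(2.14) p.268] -/
theorem beta0OfMerged_eq_beta0OfTerms {v₀ : (k : ℕ) → (Fin (k + 1) → ℝ)}
    (hsplit : ∀ k, ∀ᶠ g in 𝓝[>] (0 : ℝ), betaMerged F ℰ ρ bV k (Function.update (v₀ k) (Fin.last k) g) =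
      beta0OfTerms F ℰ0 ρ bV k + beta1OfTerms F ℰ1 ρ bV k (Function.update (v₀ k) (Fin.last k) g))
    (hvan : ∀ k, Tendsto (fun g : ℝ => beta1OfTerms F ℰ1 ρ bV k (Function.update (v₀ k) (Fin.last k) g)) (𝓝[>] 0) (𝓝 0)) :
    beta0OfMerged (betaMerged F ℰ ρ bV) v₀ = beta0OfTerms F ℰ0 ρ bV :=
  funext (beta0LimitExists_of_decomposition F ℰ ℰ0 ℰ1 ρ bV hsplit hvan).2

/-- ★ **design (β)'s β-OF-RECORD SHAPE IS design (α)'s `betaOfTerms`**: if the junction holds at EVERY box history of `]0, γ]` and the (2.12) data of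
`beta0LimitExists_of_decomposition` hold at the reference history, then `betaOfMerged (betaMerged F ℰ) (beta0OfMerged (betaMerged F ℰ) v₀) γ = betaOfTerms F ℰ⁰ ℰ¹ γ` — on the box
both read `β⁰ + β¹`, off it both read the history-free `β⁰`. [cite: Balaban1987RG1, (1.22) p.264 and (2.12)–(2.14) p.268] -/
theorem betaOfMerged_betaMerged_eq_betaOfTerms {γ : ℝ} {v₀ : (k : ℕ) → (Fin (k + 1) → ℝ)}
    (hbox : ∀ (k : ℕ) (v : Fin (k + 1) → ℝ), v ∈ Box γ k → betaMerged F ℰ ρ bV k v = beta0OfTerms F ℰ0 ρ bV k + beta1OfTerms F ℰ1 ρ bV k v)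
    (hsplit : ∀ k, ∀ᶠ g in 𝓝[>] (0 : ℝ), betaMerged F ℰ ρ bV k (Function.update (v₀ k) (Fin.last k) g) =
      beta0OfTerms F ℰ0 ρ bV k + beta1OfTerms F ℰ1 ρ bV k (Function.update (v₀ k) (Fin.last k) g))
    (hvan : ∀ k, Tendsto (fun g : ℝ => beta1OfTerms F ℰ1 ρ bV k (Function.update (v₀ k) (Fin.last k) g)) (𝓝[>] 0) (𝓝 0)) :
    betaOfMerged (betaMerged F ℰ ρ bV) (beta0OfMerged (betaMerged F ℰ ρ bV) v₀) γ = betaOfTerms F ℰ0 ℰ1 ρ bV γ := by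
  rw [beta0OfMerged_eq_beta0OfTerms F ℰ ℰ0 ℰ1 ρ bV hsplit hvan]
  funext k v
  by_cases hv : v ∈ Box γ k
  · rw [betaOfMerged_of_mem _ _ _ hv, betaOfTerms_of_mem F ℰ0 ℰ1 ρ bV γ hv, hbox k v hv]
  · unfold betaOfTerms
    rw [betaOfMerged_of_notMem _ _ _ hv, Set.indicator_of_notMem hv, add_zero]

/-- ★ **THE CORNER ANCHOR FROM THE DECOMPOSITION** (the BODY of K2's `ScaleAnchor (betaMerged F ℰ) (beta0OfTerms F ℰ⁰)`, definitionally): if the junction holds on the boxes of some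
`]0, γ₀]` and the remainder's β¹ is SMALL NEAR THE CORNER — for every `k` and `δ > 0` a box `]0, γ]` with `|β¹_k| ≤ δ` on it — then the merged β is anchored, scale by scale, at the
HISTORY-FREE numbers `beta0OfTerms F ℰ⁰` (a `v₀`-free form of the (2.12) clause). [cite: Balaban1987RG1, (2.12)–(2.14) p.268 and (1.22) p.264] -/
theorem cornerAnchor_of_decomposition {γ₀ : ℝ} (hγ₀ : 0 < γ₀)
    (hbox : ∀ (k : ℕ) (v : Fin (k + 1) → ℝ), v ∈ Box γ₀ k → betaMerged F ℰ ρ bV k v = beta0OfTerms F ℰ0 ρ bV k + beta1OfTerms F ℰ1 ρ bV k v)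
    (hsmall : ∀ (k : ℕ) (δ : ℝ), 0 < δ → ∃ γ : ℝ, 0 < γ ∧ ∀ p : Fin (k + 1) → ℝ, p ∈ HistBox γ k → |beta1OfTerms F ℰ1 ρ bV k p| ≤ δ) :
    ∀ (k : ℕ) (δ : ℝ), 0 < δ → ∃ γ : ℝ, 0 < γ ∧ ∀ p : Fin (k + 1) → ℝ, p ∈ HistBox γ k → |betaMerged F ℰ ρ bV k p - beta0OfTerms F ℰ0 ρ bV k| ≤ δ := by
  intro k δ hδ
  obtain ⟨γ, hγ, hp⟩ := hsmall k δ hδ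
  refine ⟨min γ γ₀, lt_min hγ hγ₀, fun p hpb => ?_⟩
  have hp₀ : p ∈ Box γ₀ k := FlowStep.mem_box.2 fun i => ⟨(hpb i).1, (hpb i).2.trans (min_le_right _ _)⟩
  have hpγ : p ∈ HistBox γ k := fun i => ⟨(hpb i).1, (hpb i).2.trans (min_le_left _ _)⟩
  rw [hbox k p hp₀, add_sub_cancel_left]
  exact hp p hpγ

end Designs

/-! ## §3 Model inhabitant (A6): sums of dag-n18-w2 g7's scalar two-bond families, and the decomposition instance with a RUNNING β -/

section Model

open YMDAG.N18.RunningBetaLettersModel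

variable {Λ T : Type*} [Fintype Λ] [Fintype T]

/-- The chart of a two-bond product is `C^∞`: `B ↦ c·e^{L B}` for the linear form `L = ev_{μ₁,x₁} + ev_{μ₂,x₂}` (g7's `expChart_crossMul`). [cite: Balaban1987RG1, p.264 (before (1.20)); model] -/
theorem contDiff_expChart_crossMul (c : ℝ) (μ₁ : Λ) (x₁ : T) (μ₂ : Λ) (x₂ : T) {n : WithTop ℕ∞} :
    ContDiff ℝ n (expChart (F := ℝ) (fun W : Λ → T → ℝ => c * (W μ₁ x₁ * W μ₂ x₂)) (ContinuousLinearMap.id ℝ ℝ)) := by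
  rw [expChart_crossMul]
  exact contDiff_const.mul (Real.contDiff_exp.comp (bondEval μ₁ x₁ + bondEval μ₂ x₂).contDiff)

variable (F : T4Family)

/-- The two-bond family's charts are `C²` at `0` at every level, history and volume — PART 1's hypothesis `hC`, inhabited. [cite: Balaban1987RG1, (1.20) p.264; model] -/
theorem contDiffAt_expChart_crossTermFamily (a : HBeta) (e : Fin 4 → ℤ) (k : ℕ) (v : Fin (k + 1) → ℝ) (K : ℕ) :
    ContDiffAt ℝ 2 (expChart (crossTermFamily F a e k v K) (ContinuousLinearMap.id ℝ ℝ)) 0 :=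
  (contDiff_expChart_crossMul (a k v) _ _ _ _).contDiffAt

/-- ★ **PART 1's `kernelA_add` AT THE MODEL, NON-VACUOUSLY**: the superposition of two two-bond families has limiting kernel the SUM of the two closed-form kernels.
[cite: Balaban1987RG1, (1.21) p.264; model] -/
theorem kernelA_cross_add (a a' : HBeta) (e e' : Fin 4 → ℤ) (g : ℕ → ℝ) (k : ℕ) :
    kernelA F (crossTermFamily F a e + crossTermFamily F a' e') (ContinuousLinearMap.id ℝ ℝ) (Module.Basis.singleton Unit ℝ) g k =
      crossKernel (a k (histPrefix g k)) e + crossKernel (a' k (histPrefix g k)) e' := by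
  rw [kernelA_add F _ _ _ _ (contDiffAt_expChart_crossTermFamily F a e) (contDiffAt_expChart_crossTermFamily F a' e')
    (polLimitExists_crossTermFamily F a e k _) (polLimitExists_crossTermFamily F a' e' k _)]
  funext μ ν z
  simp only [Pi.add_apply, kernelA_crossTermFamily]

/-- **PART 1's `kernelStepRate_add` AT THE MODEL**: two amplitude laws with two-run contraction `|a(k+1) w − a k (tail w)| ≤ C θ θ^k` on the boxes give node N18's letter for the
superposed family with constant `C·wt κ e + C'·wt κ e'` (g7's `kernelStepRate_cross` per summand). [cite: Balaban1987RG1, Thm 1 p.259; model] -/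
theorem kernelStepRate_cross_add {a a' : HBeta} {γ θ C C' : ℝ}
    (ha : ∀ (k : ℕ) (w : Fin (k + 2) → ℝ), w ∈ Box γ (k + 1) → |a (k + 1) w - a k (Fin.tail w)| ≤ C * θ * θ ^ k)
    (ha' : ∀ (k : ℕ) (w : Fin (k + 2) → ℝ), w ∈ Box γ (k + 1) → |a' (k + 1) w - a' k (Fin.tail w)| ≤ C' * θ * θ ^ k) (e e' : Fin 4 → ℤ) (κ : ℝ) :
    KernelStepRate F (crossTermFamily F a e + crossTermFamily F a' e') (ContinuousLinearMap.id ℝ ℝ) (Module.Basis.singleton Unit ℝ) γ κ θ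
      (C * wt κ e + C' * wt κ e') :=
  kernelStepRate_add F _ _ _ _ (contDiffAt_expChart_crossTermFamily F a e) (contDiffAt_expChart_crossTermFamily F a' e')
    (polLimitsExist_cross F a e γ) (polLimitsExist_cross F a' e' γ) (kernelStepRate_cross F ha e κ) (kernelStepRate_cross F ha' e' κ)

/-- The closed-form mixed kernel is in the (5.10) class at every rate (support `{e}`). [cite: Balaban1987RG1, (5.10) p.293; model] -/
theorem decay510_crossKernel_zero_one (c : ℝ) (e : Fin 4 → ℤ) (δ : ℝ) :
    Decay510 (crossKernel c e 0 1) (|c| * Real.exp (δ * l1 e)) δ := by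
  intro z
  rw [crossKernel_zero_one]
  by_cases hz : z = e
  · subst hz
    rw [if_pos rfl, mul_assoc, ← Real.exp_add, show δ * l1 z + -δ * l1 z = 0 by ring, Real.exp_zero, mul_one]
  · rw [if_neg hz, abs_zero]
    positivity

/-- The (1.21) limiting kernel of the two-bond family is in the (5.10) class at every rate (closed form `crossKernel`). [cite: Balaban1987RG1, (5.10) p.293; model] -/
theorem decay510_polLimit_cross (a : HBeta) (e : Fin 4 → ℤ) (k : ℕ) (v : Fin (k + 1) → ℝ) (δ : ℝ) :
    Decay510 (polLimit F (k + 1) (fun K => crossTermFamily F a e k v K) (ContinuousLinearMap.id ℝ ℝ) (Module.Basis.singleton Unit ℝ) 0 1)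
      (|a k v| * Real.exp (δ * l1 e)) δ := by
  intro z
  rw [polLimit_crossTermFamily]
  exact decay510_crossKernel_zero_one (a k v) e δ z

/-- **§1's `betaMerged_add` AT THE MODEL**: the merged β of the superposition is the sum of the two closed-form β's `a k v·e₀e₁ + a' k v·e'₀e'₁`. [cite: Balaban1987RG1, (1.22) p.264; model] -/
theorem betaMerged_cross_add (a a' : HBeta) (e e' : Fin 4 → ℤ) (k : ℕ) (v : Fin (k + 1) → ℝ) :
    betaMerged F (crossTermFamily F a e + crossTermFamily F a' e') (ContinuousLinearMap.id ℝ ℝ) (Module.Basis.singleton Unit ℝ) k v =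
      a k v * ((e 0 : ℝ) * e 1) + a' k v * ((e' 0 : ℝ) * e' 1) := by
  rw [betaMerged_add F _ _ _ _ (contDiffAt_expChart_crossTermFamily F a e) (contDiffAt_expChart_crossTermFamily F a' e')
    (polLimitExists_crossTermFamily F a e k v) (polLimitExists_crossTermFamily F a' e' k v) zero_lt_one
    (decay510_polLimit_cross F a e k v 1) (decay510_polLimit_cross F a' e' k v 1), betaMerged_crossTermFamily, betaMerged_crossTermFamily]

/-! ### The decomposition instance: amplitude law `b₀ k + v_k` — coupling-free numbers PLUS the last coupling (a RUNNING β with the (2.12) clause) -/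

/-- **THE DECOMPOSITION ON THE NOSE**: the two-bond family with law `(k, v) ↦ b₀ k + v_k` IS, at every level ∕ history ∕ volume, the SUM of the coupling-free two-bond family
with numbers `b₀` (a `TermFamily0`, read at the dummy history `0`) and the two-bond family with law `(k, v) ↦ v_k` (the remainder, vanishing with the last coupling).
[cite: Balaban1987RG1, (2.12)–(2.14) p.268; model] -/
theorem cross_decomposition (b₀ : ℕ → ℝ) (e : Fin 4 → ℤ) (k : ℕ) (v : Fin (k + 1) → ℝ) (K : ℕ) :
    crossTermFamily F (fun k v => b₀ k + v (Fin.last k)) e k v K =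
      fun W => crossTermFamily F (fun k _ => b₀ k) e k 0 K W + crossTermFamily F (fun k v => v (Fin.last k)) e k v K W := by
  funext W
  simp only [crossTermFamily]
  ring

/-- design (α)'s one-loop number of the coupling-free piece: `β⁰_k = b₀ k·e₀e₁` (history-free by typing AND in value). [cite: Balaban1987RG1, (2.12) p.268 and (1.22) p.264; model] -/
theorem beta0OfTerms_crossConst (b₀ : ℕ → ℝ) (e : Fin 4 → ℤ) (k : ℕ) :
    beta0OfTerms F (fun k K => crossTermFamily F (fun k _ => b₀ k) e k 0 K) (ContinuousLinearMap.id ℝ ℝ) (Module.Basis.singleton Unit ℝ) k = b₀ k * ((e 0 : ℝ) * e 1) := by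
  have h := congrFun (congrFun (betaMerged_crossTermFamily F (fun k _ => b₀ k) e) k) (0 : Fin (k + 1) → ℝ)
  exact h

/-- design (α)'s remainder β of the last-coupling piece: `β¹_k(v) = v_k·e₀e₁`. [cite: Balaban1987RG1, (2.13) p.268 and (1.22) p.264; model] -/
theorem beta1OfTerms_crossLast (e : Fin 4 → ℤ) (k : ℕ) (v : Fin (k + 1) → ℝ) :
    beta1OfTerms F (crossTermFamily F (fun k v => v (Fin.last k)) e) (ContinuousLinearMap.id ℝ ℝ) (Module.Basis.singleton Unit ℝ) k v =
      v (Fin.last k) * ((e 0 : ℝ) * e 1) :=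
  congrFun (congrFun (betaMerged_crossTermFamily F (fun k v => v (Fin.last k)) e) k) v

/-- **§2's JUNCTION AT THE MODEL** (`betaMerged_eq_beta0OfTerms_add_beta1OfTerms` applied — every hypothesis inhabited: decomposition on the nose, `C^∞` charts, (1.21) existence,
(5.10) class of the closed-form kernels): `β_m(v) = β⁰_k + β¹_k(v)` at EVERY history. [cite: Balaban1987RG1, (1.22) p.264 and (2.12)–(2.14) p.268; model] -/
theorem betaMerged_crossRunning_split (b₀ : ℕ → ℝ) (e : Fin 4 → ℤ) (k : ℕ) (v : Fin (k + 1) → ℝ) :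
    betaMerged F (crossTermFamily F (fun k v => b₀ k + v (Fin.last k)) e) (ContinuousLinearMap.id ℝ ℝ) (Module.Basis.singleton Unit ℝ) k v =
      beta0OfTerms F (fun k K => crossTermFamily F (fun k _ => b₀ k) e k 0 K) (ContinuousLinearMap.id ℝ ℝ) (Module.Basis.singleton Unit ℝ) k +
        beta1OfTerms F (crossTermFamily F (fun k v => v (Fin.last k)) e) (ContinuousLinearMap.id ℝ ℝ) (Module.Basis.singleton Unit ℝ) k v :=
  betaMerged_eq_beta0OfTerms_add_beta1OfTerms F _ _ _ _ _ (Eventually.of_forall fun K => cross_decomposition F b₀ e k v K)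
    (fun K => contDiffAt_expChart_crossTermFamily F (fun k _ => b₀ k) e k 0 K) (fun K => contDiffAt_expChart_crossTermFamily F (fun k v => v (Fin.last k)) e k v K)
    (polLimitExists_crossTermFamily F _ e k 0) (polLimitExists_crossTermFamily F _ e k v) zero_lt_one
    (decay510_polLimit_cross F (fun k _ => b₀ k) e k 0 1) (decay510_polLimit_cross F (fun k v => v (Fin.last k)) e k v 1)

/-- The remainder's β¹ VANISHES AT THE FACE `g_k → 0⁺` (print p. 268), at every reference history. [cite: Balaban1987RG1, (2.13) p.268; model] -/
theorem tendsto_beta1OfTerms_crossLast (e : Fin 4 → ℤ) (v₀ : (k : ℕ) → (Fin (k + 1) → ℝ)) (k : ℕ) :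
    Tendsto (fun g : ℝ => beta1OfTerms F (crossTermFamily F (fun k v => v (Fin.last k)) e) (ContinuousLinearMap.id ℝ ℝ) (Module.Basis.singleton Unit ℝ) k
      (Function.update (v₀ k) (Fin.last k) g)) (𝓝[>] 0) (𝓝 0) := by
  simp only [beta1OfTerms_crossLast, Function.update_self]
  have h : Tendsto (fun g : ℝ => g * ((e 0 : ℝ) * e 1)) (𝓝 0) (𝓝 (0 * ((e 0 : ℝ) * e 1))) := tendsto_id.mul_const _
  rw [zero_mul] at h
  exact h.mono_left nhdsWithin_le_nhds

/-- ★ **THE (2.12) CLAUSE FOR A RUNNING β, BY §2's THEOREM, NON-VACUOUSLY**: the two-bond family with law `b₀ k + v_k` has `Beta0LimitExists` at EVERY reference history `v₀`, with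
the HISTORY-FREE one-loop number `b₀ k·e₀e₁` — while its β RUNS with the last coupling. [cite: Balaban1987RG1, (2.12)–(2.14) p.268 and (1.22) p.264; model] -/
theorem beta0LimitExists_crossRunning (b₀ : ℕ → ℝ) (e : Fin 4 → ℤ) (v₀ : (k : ℕ) → (Fin (k + 1) → ℝ)) :
    Beta0LimitExists (betaMerged F (crossTermFamily F (fun k v => b₀ k + v (Fin.last k)) e) (ContinuousLinearMap.id ℝ ℝ) (Module.Basis.singleton Unit ℝ)) v₀ ∧
      ∀ k, beta0OfMerged (betaMerged F (crossTermFamily F (fun k v => b₀ k + v (Fin.last k)) e) (ContinuousLinearMap.id ℝ ℝ) (Module.Basis.singleton Unit ℝ)) v₀ k =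
        b₀ k * ((e 0 : ℝ) * e 1) := by
  have h := beta0LimitExists_of_decomposition F (crossTermFamily F (fun k v => b₀ k + v (Fin.last k)) e)
    (fun k K => crossTermFamily F (fun k _ => b₀ k) e k 0 K) (crossTermFamily F (fun k v => v (Fin.last k)) e) (ContinuousLinearMap.id ℝ ℝ)
    (Module.Basis.singleton Unit ℝ) (v₀ := v₀) (fun k => Eventually.of_forall fun g => betaMerged_crossRunning_split F b₀ e k _)
    (tendsto_beta1OfTerms_crossLast F e v₀)
  exact ⟨h.1, fun k => (h.2 k).trans (beta0OfTerms_crossConst F b₀ e k)⟩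

/-- **THE CORNER ANCHOR FOR THE RUNNING MODEL, BY §2's THEOREM** (the body of `ScaleAnchor β_m (k ↦ b₀ k·e₀e₁)`): `|β¹_k(p)| = p_k·|e₀e₁| ≤ δ` on the box `]0, δ∕(1+|e₀e₁|)]`.
[cite: Balaban1987RG1, (2.12)–(2.14) p.268; model] -/
theorem cornerAnchor_crossRunning (b₀ : ℕ → ℝ) (e : Fin 4 → ℤ) :
    ∀ (k : ℕ) (δ : ℝ), 0 < δ → ∃ γ : ℝ, 0 < γ ∧ ∀ p : Fin (k + 1) → ℝ, p ∈ HistBox γ k →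
      |betaMerged F (crossTermFamily F (fun k v => b₀ k + v (Fin.last k)) e) (ContinuousLinearMap.id ℝ ℝ) (Module.Basis.singleton Unit ℝ) k p - b₀ k * ((e 0 : ℝ) * e 1)| ≤ δ := by
  have h := cornerAnchor_of_decomposition F (crossTermFamily F (fun k v => b₀ k + v (Fin.last k)) e)
    (fun k K => crossTermFamily F (fun k _ => b₀ k) e k 0 K) (crossTermFamily F (fun k v => v (Fin.last k)) e) (ContinuousLinearMap.id ℝ ℝ)
    (Module.Basis.singleton Unit ℝ) (γ₀ := 1) zero_lt_one (fun k v _ => betaMerged_crossRunning_split F b₀ e k v) ?_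
  · intro k δ hδ
    obtain ⟨γ, hγ, hp⟩ := h k δ hδ
    exact ⟨γ, hγ, fun p hpb => (beta0OfTerms_crossConst F b₀ e k) ▸ hp p hpb⟩
  · intro k δ hδ
    set M : ℝ := |((e 0 : ℝ) * e 1)| with hM
    refine ⟨δ / (1 + M), div_pos hδ (by positivity), fun p hp => ?_⟩
    rw [beta1OfTerms_crossLast, abs_mul, ← hM]
    have hpk : |p (Fin.last k)| ≤ δ / (1 + M) := by
      rw [abs_of_pos (hp (Fin.last k)).1]
      exact (hp (Fin.last k)).2
    have hM0 : 0 ≤ M := abs_nonneg _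
    calc |p (Fin.last k)| * M ≤ δ / (1 + M) * M := mul_le_mul_of_nonneg_right hpk hM0
      _ ≤ δ / (1 + M) * (1 + M) := mul_le_mul_of_nonneg_left (by linarith) (div_pos hδ (by positivity)).le
      _ = δ := div_mul_cancel₀ δ (by positivity)

end Model

end YMDAG.N18.BetaSuperposition

end
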